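import Literature.NumberTheory.GaloisRepresentations.HasseNormEtaleInvolutionNorm
import Literature.NumberTheory.GaloisRepresentations.HasseNormEtaleInvolutionDescent
import HarnessLib

/-!
# The determinant of the adelic Cartan class, factor by factor (Ⅱ-S): at a `τ`-STABLE factor `𝔪` the `𝔸_L`-norm is the base change of
# the `K₀`-norm of the descended idèle — `N_{C∕L}(con_{C∕K₀} W) = con_{L∕F}(N_{K₀∕F} W)` for the linearly disjoint compositum `C = L·K₀`
(Rogawski 1990 §3.5 Prop. 3.5.2, pp. 29–30; Cassels–Fröhlich II §19 (19.1), (19.7), (19.13))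

Topic `NumberTheory/GaloisRepresentations`; namespace `Literature.NumberTheory.GaloisRepresentations`.  THEOREMS ONLY (no definition, no instance,
no notation, no named fact); universe `Type`.  FILE S of the det-reading (Ⅱ) of row G6∕R6d «Cartan obstruction» (floor-0 unitary stabilisation,
engine T1; spec `SPEC-detreading-II` of the HCML F0∕P3a seat F0P4-p05 (g4), 3e43752a): the factor `ν_𝔪 = N_{(𝔸_L ⊗_L K_𝔪)∕𝔸_L}(θ_𝔪((1 ⊗ π_𝔪) X))`
of ★ (Ⅱa) `det_eq_prod_norm_transfer` at a PRESENTED `τ`-stable maximal ideal `𝔪 = ker π` of `B = L[γ]` (`π : B ↠ C`, `τ_C` the induced involution of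
the number field `C`, `K₀ = C^{τ_C}`), read as the base change `con_{L∕F}` of the idelic norm `N_{K₀∕F} W` of the descended idèle `W`
(`con_{C∕K₀} W = ` the image of `X` in `𝔸_C`).  The number-theoretic content is the LINEARLY DISJOINT SQUARE `F ⊂ L, K₀ ⊂ C = L·K₀`
(`[L:F] = [C:K₀] = 2`, `L ⊄ K₀` because `τ_C` restricts to `σ ≠ 1` on `L`): there `N_{C∕L} ∘ con_{C∕K₀} = con_{L∕F} ∘ N_{K₀∕F}` on adèles.

* §1 `exists_algEquiv_tensor_of_finrank_eq_two` — the square is linearly disjoint: `L ⊗_F K₀ ≃ₐ[L] C` (`1 ⊗ k ↦ k`) from `[L:F] = [C:K₀] = 2` and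
  one element of `L` outside `K₀` (degree count; no Galois theory).
* §2 **`adeleRelNorm_baseChange_eq_baseChange_adeleRelNorm`** — for number fields in such a square (the disjointness given as `L ⊗_F K₀ ≃ₐ[L] C`):
  `N_{C∕L}(con_{C∕K₀} w) = con_{L∕F}(N_{K₀∕F} w)` for every adèle `w ∈ 𝔸_{K₀}` (Cassels's norms ★ `adeleRelNorm`, conorms `NumberField.AdeleRing.baseChange`):
  ★ `norm_basis_map` (naturality of `Nm_{(A ⊗_F K₀)∕A}` in the coefficient ring `A`, at `con_{L∕F} : 𝔸_F → 𝔸_L`) read through (19.1) ★ `adeleRingTensorAlgEquiv`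
  and the `𝔸_L`-algebra isomorphism `𝔸_L ⊗_F K₀ ≅ 𝔸_L ⊗_L (L ⊗_F K₀) ≅ 𝔸_L ⊗_L C ≅ 𝔸_C` (no instance is declared: the tower `𝔸_F → 𝔸_{K₀} → 𝔸_C` enters only through (19.3)).
* §3 **`norm_transfer_mk_eq_baseChange_ideleRelNorm`** = the spec's `spec_S_…` (binders verbatim, minus the idle ones): the factor norm at the presented
  stable ideal is `con_{L∕F}(N_{K₀∕F} W)` — `B ∕ 𝔪 ≃ₐ[L] C` along `π`, transport of `Algebra.norm 𝔸_L` along `𝔸_L ⊗_L (B∕𝔪) ≅ 𝔸_L ⊗_L C ≅ 𝔸_C`, the transfer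
  `θ_𝔪` and ★ `adeleRingTensorAlgEquiv_tower`, the presentation `hW` of the descended idèle, then §2.

## References
* J. D. Rogawski, *Automorphic Representations of Unitary Groups in Three Variables*, Ann. of Math. Stud. 123 (1990), §3.5 Prop. 3.5.2, pp. 29–30
  [Rogawski1990].
* J. W. S. Cassels, A. Fröhlich (eds.), *Algebraic Number Theory* (1967), Ch. II (Cassels) §19 (19.1), (19.7), (19.13) [CasselsFrohlichANT1967].
-/

set_option autoImplicit false

noncomputable section

open scoped TensorProduct NumberField NumberField.AdeleRing

namespace Literature.NumberTheory.GaloisRepresentations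

open NumberField IsDedekindDomain Module
open Literature.NumberTheory.AdelicBaseChange Literature.NumberTheory.Automorphic

/-! ## §1 The linearly disjoint square `F ⊂ L, K₀ ⊂ C`: `L ⊗_F K₀ ≅ C` -/

section Square

variable (F L C : Type) [Field F] [Field L] [Field C] [Algebra F L] [Algebra F C] [Algebra L C] [IsScalarTower F L C]
  [FiniteDimensional F C] (K₀ : IntermediateField F C)

/-- **The square `F ⊂ L, K₀ ⊂ C` with `[L : F] = [C : K₀] = 2` and `L ⊄ K₀` is a linearly disjoint compositum**: the multiplication map
`L ⊗_F K₀ → C` is an `L`-algebra isomorphism (`K₀ < L·K₀ ≤ C` and `[C : K₀] = 2` is prime, so `L·K₀ = C`; then `dim_F (L ⊗_F K₀) = 2 [K₀:F] = [C:F]`).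
[cite: Rogawski1990, §3.5 p. 29–30] -/
theorem exists_algEquiv_tensor_of_finrank_eq_two (hL : finrank F L = 2) (hC : finrank K₀ C = 2) (hℓ : ∃ ℓ : L, algebraMap L C ℓ ∉ K₀) :
    ∃ e : L ⊗[F] K₀ ≃ₐ[L] C, ∀ k : K₀, e (1 ⊗ₜ k) = (k : C) := by
  -- the multiplication map, `L`-linear on the left factor
  let ψ : L ⊗[F] K₀ →ₐ[L] C :=
    Algebra.TensorProduct.lift (Algebra.ofId L C) (K₀.val) fun _ _ => Commute.all _ _
  have hψ : ∀ (ℓ : L) (k : K₀), ψ (ℓ ⊗ₜ k) = algebraMap L C ℓ * (k : C) := fun ℓ k => by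
    rw [Algebra.TensorProduct.lift_tmul]; rfl
  -- `L·K₀ = C`: the intermediate field generated by `K₀` and the image of `L` is everything
  let L' : IntermediateField F C := (IsScalarTower.toAlgHom F L C).fieldRange
  have hsup : L' ⊔ K₀ = ⊤ := by
    have hle : K₀ ≤ L' ⊔ K₀ := le_sup_right
    have hdvd : finrank ↥(L' ⊔ K₀) C ∣ 2 := hC ▸ IntermediateField.finrank_dvd_of_le_left hle
    rcases (Nat.dvd_prime Nat.prime_two).1 hdvd with h1 | h2
    · exact IntermediateField.finrank_eq_one_iff_eq_top.1 h1
    · exfalso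
      obtain ⟨ℓ, hℓ⟩ := hℓ
      have hK : K₀ = L' ⊔ K₀ := IntermediateField.eq_of_le_of_finrank_eq' hle (hC.trans h2.symm)
      apply hℓ
      rw [hK]
      exact le_sup_left (b := K₀) (⟨ℓ, rfl⟩ : algebraMap L C ℓ ∈ L')
  -- hence `ψ` is surjective
  have hsurj : Function.Surjective ψ := by
    have hrange : (ψ.restrictScalars F).range = ⊤ := by
      apply top_le_iff.1
      rw [← IntermediateField.top_toSubalgebra, ← hsup, IntermediateField.sup_toSubalgebra_of_right]
      refine sup_le ?_ ?_
      · intro x hx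
        obtain ⟨ℓ, rfl⟩ := AlgHom.mem_fieldRange.1 ((IntermediateField.mem_toSubalgebra _ _).1 hx)
        refine ⟨ℓ ⊗ₜ 1, ?_⟩
        change ψ (ℓ ⊗ₜ 1) = algebraMap L C ℓ
        rw [hψ, OneMemClass.coe_one, mul_one]
      · intro k hk
        refine ⟨(1 : L) ⊗ₜ ⟨k, hk⟩, ?_⟩
        change ψ ((1 : L) ⊗ₜ ⟨k, hk⟩) = k
        rw [hψ, map_one, one_mul]
    exact fun c => by
      have hc : c ∈ (ψ.restrictScalars F).range := hrange ▸ Algebra.mem_top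
      obtain ⟨x, hx⟩ := hc
      exact ⟨x, hx⟩
  -- and injective by the dimension count `dim_F (L ⊗ K₀) = 2·[K₀:F] = [C:F]`
  haveI : FiniteDimensional F L := Module.finite_of_finrank_eq_succ hL
  have hdim : finrank F (L ⊗[F] K₀) = finrank F C := by
    rw [Module.finrank_tensorProduct, hL, ← Module.finrank_mul_finrank F K₀ C, hC, mul_comm]
  have hinj : Function.Injective ψ :=
    (LinearMap.injective_iff_surjective_of_finrank_eq_finrank hdim (f := (ψ.restrictScalars F).toLinearMap)).2 hsurj
  refine ⟨AlgEquiv.ofBijective ψ ⟨hinj, hsurj⟩, fun k => ?_⟩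
  rw [AlgEquiv.ofBijective_apply, hψ, map_one, one_mul]

end Square

/-! ## §2 `N_{C∕L} ∘ con_{C∕K₀} = con_{L∕F} ∘ N_{K₀∕F}` on adèles, for a linearly disjoint square of number fields -/

section AdelicSquare

variable (F L K₀ C : Type) [Field F] [NumberField F] [Field L] [NumberField L] [Field K₀] [NumberField K₀] [Field C] [NumberField C]
  [Algebra F L] [Algebra F K₀] [Algebra F C] [Algebra L C] [Algebra K₀ C] [IsScalarTower F L C] [IsScalarTower F K₀ C]
  [Algebra F (AdeleRing (𝓞 L) L)] [IsScalarTower F L (AdeleRing (𝓞 L) L)]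

/-- **NORMS IN A LINEARLY DISJOINT SQUARE OF NUMBER FIELDS**: if `L ⊗_F K₀ ≅ C` (`1 ⊗ k ↦ k`, `L`-linearly), then for every adèle `w ∈ 𝔸_{K₀}`
`N_{C∕L}(con_{C∕K₀} w) = con_{L∕F}(N_{K₀∕F} w)` in `𝔸_L` (Cassels's (19.7) norms and (19.2) conorms).  Write `w = e_{K₀∕F}(y)`, `y ∈ 𝔸_F ⊗_F K₀` (19.1);
the naturality of `Nm_{(A ⊗_F K₀)∕A}` in `A` (★ `norm_basis_map` at `con_{L∕F} : 𝔸_F → 𝔸_L`) gives `Nm_{𝔸_L}((con ⊗ 1) y) = con(Nm_{𝔸_F} y)`, and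
`𝔸_L ⊗_F K₀ ≅ 𝔸_L ⊗_L (L ⊗_F K₀) ≅ 𝔸_L ⊗_L C ≅ 𝔸_C` (19.1) carries `(con ⊗ 1) y` to `con_{C∕K₀} w` (★ `adeleRingTensorAlgEquiv_tower`,
(19.3) ★ `adeleRing_baseChange_baseChange`). [cite: CasselsFrohlichANT1967, Ch. II §19 (19.1)–(19.3), (19.7)] [cite: Rogawski1990, §3.5 p. 29–30] -/
theorem adeleRelNorm_baseChange_eq_baseChange_adeleRelNorm (e : L ⊗[F] K₀ ≃ₐ[L] C) (he : ∀ k : K₀, e (1 ⊗ₜ k) = algebraMap K₀ C k)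
    (w : AdeleRing (𝓞 K₀) K₀) :
    adeleRelNorm L C (NumberField.AdeleRing.baseChange K₀ C w) = NumberField.AdeleRing.baseChange F L (adeleRelNorm F K₀ w) := by
  classical
  -- `con_{L∕F}` as an `F`-algebra map
  haveI : IsScalarTower F (AdeleRing (𝓞 F) F) (AdeleRing (𝓞 L) L) :=
    IsScalarTower.of_algebraMap_eq fun f => by
      change algebraMap F (AdeleRing (𝓞 L) L) f = NumberField.AdeleRing.baseChange F L (algebraMap F (AdeleRing (𝓞 F) F) f)
      rw [adeleRing_baseChange_algebraMap, IsScalarTower.algebraMap_apply F L (AdeleRing (𝓞 L) L)]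
  obtain ⟨y, rfl⟩ := (adeleRingTensorAlgEquiv F K₀).surjective w
  -- `con_{L∕F}` as an `F`-algebra map
  let φ : AdeleRing (𝓞 F) F →ₐ[F] AdeleRing (𝓞 L) L := IsScalarTower.toAlgHom F (AdeleRing (𝓞 F) F) (AdeleRing (𝓞 L) L)
  -- the `𝔸_L`-algebra isomorphism `𝔸_L ⊗_F K₀ ≅ 𝔸_L ⊗_L (L ⊗_F K₀) ≅ 𝔸_L ⊗_L C ≅ 𝔸_C`
  let Θ : AdeleRing (𝓞 L) L ⊗[F] K₀ ≃ₐ[AdeleRing (𝓞 L) L] AdeleRing (𝓞 C) C :=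
    ((Algebra.TensorProduct.cancelBaseChange F L (AdeleRing (𝓞 L) L) (AdeleRing (𝓞 L) L) K₀).symm.trans
      (Algebra.TensorProduct.congr (AlgEquiv.refl : AdeleRing (𝓞 L) L ≃ₐ[AdeleRing (𝓞 L) L] AdeleRing (𝓞 L) L) e)).trans
      (adeleRingTensorAlgEquiv L C)
  -- … which carries `(con ⊗ 1) z` to `con_{C∕K₀}(e_{K₀∕F} z)`
  have hΘ : ∀ z : AdeleRing (𝓞 F) F ⊗[F] K₀,
      Θ (Algebra.TensorProduct.map φ (AlgHom.id F K₀) z) =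
        NumberField.AdeleRing.baseChange K₀ C (adeleRingTensorAlgEquiv F K₀ z) := by
    intro z
    induction z using TensorProduct.induction_on with
    | zero => simp only [map_zero]
    | tmul a k =>
        rw [Algebra.TensorProduct.map_tmul, AlgHom.id_apply]
        change adeleRingTensorAlgEquiv L C (Algebra.TensorProduct.congr AlgEquiv.refl e
          ((Algebra.TensorProduct.cancelBaseChange F L (AdeleRing (𝓞 L) L) (AdeleRing (𝓞 L) L) K₀).symm
            (NumberField.AdeleRing.baseChange F L a ⊗ₜ k))) =
          NumberField.AdeleRing.baseChange K₀ C (adeleRingTensorAlgEquiv F K₀ (a ⊗ₜ k))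
        rw [Algebra.TensorProduct.cancelBaseChange_symm_tmul, Algebra.TensorProduct.congr_apply, Algebra.TensorProduct.map_tmul]
        change adeleRingTensorAlgEquiv L C (NumberField.AdeleRing.baseChange F L a ⊗ₜ e (1 ⊗ₜ k)) = _
        rw [he, adeleRingTensorAlgEquiv_tower, adeleRingTensorAlgEquiv_tmul, adeleRingTensorAlgEquiv_tmul, map_mul,
          adeleRing_baseChange_algebraMap, adeleRing_baseChange_baseChange]
    | add x y hx hy => rw [map_add, map_add, hx, hy, map_add, map_add]
  -- the norm computation
  calc adeleRelNorm L C (NumberField.AdeleRing.baseChange K₀ C (adeleRingTensorAlgEquiv F K₀ y))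
      = Algebra.norm (AdeleRing (𝓞 L) L) (Θ (Algebra.TensorProduct.map φ (AlgHom.id F K₀) y)) := by rw [adeleRelNorm_apply, hΘ]
    _ = Algebra.norm (AdeleRing (𝓞 L) L) (Algebra.TensorProduct.map φ (AlgHom.id F K₀) y) := Algebra.norm_eq_of_algEquiv Θ _
    _ = φ (Algebra.norm (AdeleRing (𝓞 F) F) y) := norm_basis_map (Module.Free.chooseBasis F K₀) φ y
    _ = NumberField.AdeleRing.baseChange F L (adeleRelNorm F K₀ (adeleRingTensorAlgEquiv F K₀ y)) := by
        rw [adeleRelNorm_apply, Algebra.norm_eq_of_algEquiv]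
        rfl

omit [Algebra F (AdeleRing (𝓞 L) L)] [IsScalarTower F L (AdeleRing (𝓞 L) L)] in
/-- **Transport of the factor norm to `𝔸_C`** (generic): for an `L`-algebra `M` over `F`, an ideal `J` with `M ∕ J ≃ₐ[L] C` (`C` a number field) matching
`π : M → C` on representatives, and a transfer `θ : 𝔸_F ⊗_F (M ∕ J) ≅ 𝔸_L ⊗_L (M ∕ J)` (`a ⊗ m ↦ con a ⊗ m`), the `𝔸_L`-norm of `θ((1 ⊗ π_J) z)` is `N_{C∕L}` of the
image `e_{C∕F}((1 ⊗ π) z) ∈ 𝔸_C` — transport along `𝔸_L ⊗_L (M ∕ J) ≅ 𝔸_L ⊗_L C ≅ 𝔸_C` (19.1), ★ `adeleRingTensorAlgEquiv_tower`.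
[cite: CasselsFrohlichANT1967, Ch. II §19 (19.1), (19.7)] -/
theorem norm_transfer_mk_eq_adeleRelNorm (M : Type) [CommRing M] [Algebra F M] [Algebra L M] [IsScalarTower F L M] (J : Ideal M)
    (eJ : (M ⧸ J) ≃ₐ[L] C) (π : M →ₐ[F] C) (hπ : ∀ m, eJ (Ideal.Quotient.mk J m) = π m)
    (θ : AdeleRing (𝓞 F) F ⊗[F] (M ⧸ J) ≃+* AdeleRing (𝓞 L) L ⊗[L] (M ⧸ J))
    (hθ : ∀ (a : AdeleRing (𝓞 F) F) (m : M ⧸ J), θ (a ⊗ₜ m) = NumberField.AdeleRing.baseChange F L a ⊗ₜ m)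
    (z : AdeleRing (𝓞 F) F ⊗[F] M) :
    Algebra.norm (AdeleRing (𝓞 L) L)
        (θ (Algebra.TensorProduct.map (AlgHom.id (AdeleRing (𝓞 F) F) (AdeleRing (𝓞 F) F)) (Ideal.Quotient.mkₐ F J) z)) =
      adeleRelNorm L C (adeleRingTensorAlgEquiv F C
        (Algebra.TensorProduct.map (AlgHom.id (AdeleRing (𝓞 F) F) (AdeleRing (𝓞 F) F)) π z)) := by
  let Ω : AdeleRing (𝓞 L) L ⊗[L] (M ⧸ J) ≃ₐ[AdeleRing (𝓞 L) L] AdeleRing (𝓞 C) C :=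
    (Algebra.TensorProduct.congr (AlgEquiv.refl : AdeleRing (𝓞 L) L ≃ₐ[AdeleRing (𝓞 L) L] AdeleRing (𝓞 L) L) eJ).trans
      (adeleRingTensorAlgEquiv L C)
  have hΩ : ∀ z : AdeleRing (𝓞 F) F ⊗[F] M,
      Ω (θ (Algebra.TensorProduct.map (AlgHom.id (AdeleRing (𝓞 F) F) (AdeleRing (𝓞 F) F)) (Ideal.Quotient.mkₐ F J) z)) =
        adeleRingTensorAlgEquiv F C (Algebra.TensorProduct.map (AlgHom.id (AdeleRing (𝓞 F) F) (AdeleRing (𝓞 F) F)) π z) := by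
    intro z
    induction z using TensorProduct.induction_on with
    | zero => simp only [map_zero]
    | tmul a b =>
        rw [Algebra.TensorProduct.map_tmul, Algebra.TensorProduct.map_tmul, AlgHom.id_apply, Ideal.Quotient.mkₐ_eq_mk, hθ]
        change adeleRingTensorAlgEquiv L C (Algebra.TensorProduct.congr AlgEquiv.refl eJ
          (NumberField.AdeleRing.baseChange F L a ⊗ₜ Ideal.Quotient.mk J b)) = _
        rw [Algebra.TensorProduct.congr_apply, Algebra.TensorProduct.map_tmul]
        change adeleRingTensorAlgEquiv L C (NumberField.AdeleRing.baseChange F L a ⊗ₜ eJ (Ideal.Quotient.mk J b)) = _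
        rw [hπ, adeleRingTensorAlgEquiv_tower]
    | add x y hx hy => simp only [map_add, hx, hy]
  rw [← Algebra.norm_eq_of_algEquiv Ω, hΩ, adeleRelNorm_apply]

end AdelicSquare

/-! ## §3 The factor norm at a presented `τ`-stable maximal ideal of `L[γ]` -/

section Stable

variable {F L : Type} [Field F] [NumberField F] [Field L] [NumberField L] [Algebra F L]

/-- **(N3) THE STABLE FACTOR** (spec `spec_S_norm_transfer_mk_eq_baseChange_ideleRelNorm`, idle binders dropped): for `B = L[γ] ⊂ M_N(L)` with a
`σ`-semilinear `F`-involution `τ` (`σ ≠ 1`, `[L : F] = 2`), a unit `X` of `𝔸_F ⊗_F B`, a maximal ideal `𝔪` of `B` PRESENTED as the kernel of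
`π : B ↠ C` onto a number field `C` carrying the induced involution `τ_C` (`π ∘ τ = τ_C ∘ π`), the idèle `W` of the fixed field `K₀ = C^{τ_C}` descending the
image of `X` in `𝔸_C` (`hW`), and ANY transfer `θ_𝔪 : 𝔸_F ⊗_F (B ∕ 𝔪) ≅ 𝔸_L ⊗_L (B ∕ 𝔪)` (`a ⊗ m ↦ con a ⊗ m`):
`N_{(𝔸_L ⊗_L B∕𝔪)∕𝔸_L}(θ_𝔪((1 ⊗ π_𝔪) X)) = con_{L∕F}(N_{K₀∕F} W)`.  Proof: `B ∕ 𝔪 ≃ₐ[L] C` along `π` (`C` an `L`-algebra through `π`), so the norm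
is `N_{C∕L}` of the image of `X` in `𝔸_C` (★ `adeleRingTensorAlgEquiv_tower`), i.e. of `con_{C∕K₀} W`; `τ_C` restricts to `σ` on `L`, so `τ_C² = 1 ≠ τ_C`,
`[C : K₀] = 2` (`finrank_fixedField_eq_card`) and `L ⊄ K₀`; §1–§2 give `N_{C∕L}(con_{C∕K₀} W) = con_{L∕F}(N_{K₀∕F} W)`.
[cite: Rogawski1990, §3.5 Prop. 3.5.2, p. 29–30] [cite: CasselsFrohlichANT1967, Ch. II §19 (19.1), (19.7), (19.13)] -/
theorem norm_transfer_mk_eq_baseChange_ideleRelNorm (σ : L ≃ₐ[F] L) (hσ1 : σ ≠ 1) [Algebra.IsQuadraticExtension F L]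
    [Algebra F (AdeleRing (𝓞 L) L)] [IsScalarTower F L (AdeleRing (𝓞 L) L)]
    {N : ℕ} {γ : Matrix (Fin N) (Fin N) L}
    (τ : ↥(Algebra.adjoin L ({γ} : Set (Matrix (Fin N) (Fin N) L))) ≃ₐ[F] ↥(Algebra.adjoin L ({γ} : Set (Matrix (Fin N) (Fin N) L))))
    (hτ : ∀ b, τ (τ b) = b) (hτσ : ∀ (ℓ : L) (b : ↥(Algebra.adjoin L ({γ} : Set (Matrix (Fin N) (Fin N) L)))), τ (ℓ • b) = σ ℓ • τ b)
    (X : (AdeleRing (𝓞 F) F ⊗[F] ↥(Algebra.adjoin L ({γ} : Set (Matrix (Fin N) (Fin N) L))))ˣ)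
    (I : MaximalSpectrum ↥(Algebra.adjoin L ({γ} : Set (Matrix (Fin N) (Fin N) L))))
    {C : Type} [Field C] [NumberField C] [Algebra F C]
    (π : ↥(Algebra.adjoin L ({γ} : Set (Matrix (Fin N) (Fin N) L))) →ₐ[F] C) (hπ : Function.Surjective π) (hker : ∀ b, π b = 0 ↔ b ∈ I.asIdeal)
    (τC : C ≃ₐ[F] C) (hτπ : ∀ b, π (τ b) = τC (π b))
    (W : (AdeleRing (𝓞 ↥(IntermediateField.fixedField (Subgroup.zpowers τC))) ↥(IntermediateField.fixedField (Subgroup.zpowers τC)))ˣ)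
    (hW : AdeleRing.ideleBaseChange (↥(IntermediateField.fixedField (Subgroup.zpowers τC))) C W =
      Units.map ((adeleRingTensorAlgEquiv F C).toAlgHom.comp
        (Algebra.TensorProduct.map (AlgHom.id (AdeleRing (𝓞 F) F) (AdeleRing (𝓞 F) F)) π)).toRingHom.toMonoidHom X)
    (θI : AdeleRing (𝓞 F) F ⊗[F] (↥(Algebra.adjoin L ({γ} : Set (Matrix (Fin N) (Fin N) L))) ⧸ I.asIdeal) ≃+*
      AdeleRing (𝓞 L) L ⊗[L] (↥(Algebra.adjoin L ({γ} : Set (Matrix (Fin N) (Fin N) L))) ⧸ I.asIdeal))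
    (hθI : ∀ (a : AdeleRing (𝓞 F) F) (m : ↥(Algebra.adjoin L ({γ} : Set (Matrix (Fin N) (Fin N) L))) ⧸ I.asIdeal),
      θI (a ⊗ₜ m) = NumberField.AdeleRing.baseChange F L a ⊗ₜ m) :
    Algebra.norm (AdeleRing (𝓞 L) L)
        (θI (Algebra.TensorProduct.map (AlgHom.id (AdeleRing (𝓞 F) F) (AdeleRing (𝓞 F) F)) (Ideal.Quotient.mkₐ F I.asIdeal) ↑X)) =
      NumberField.AdeleRing.baseChange F L
        (((AdelicBaseChange.ideleRelNorm F ↥(IntermediateField.fixedField (Subgroup.zpowers τC)) W :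
          (AdeleRing (𝓞 F) F)ˣ) : AdeleRing (𝓞 F) F)) := by
  -- `C` is an `L`-algebra through `π`, and `τ_C` restricts to `σ` on `L`
  letI : Algebra L C :=
    ((π : ↥(Algebra.adjoin L ({γ} : Set (Matrix (Fin N) (Fin N) L))) →ₐ[F] C).toRingHom.comp
      (algebraMap L ↥(Algebra.adjoin L ({γ} : Set (Matrix (Fin N) (Fin N) L))))).toAlgebra
  have hLC : ∀ ℓ : L, algebraMap L C ℓ = π (algebraMap L ↥(Algebra.adjoin L ({γ} : Set (Matrix (Fin N) (Fin N) L))) ℓ) := fun ℓ => rfl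
  haveI : IsScalarTower F L C := IsScalarTower.of_algebraMap_eq fun f => by
    rw [hLC, ← IsScalarTower.algebraMap_apply F L, AlgHom.commutes]
  have hτL : ∀ ℓ : L, τC (algebraMap L C ℓ) = algebraMap L C (σ ℓ) := fun ℓ => by
    rw [hLC, hLC, ← hτπ, Algebra.algebraMap_eq_smul_one, hτσ, map_one, Algebra.algebraMap_eq_smul_one]
  -- `τ_C² = 1`, `τ_C ≠ 1`: `[C : K₀] = 2` and `L ⊄ K₀`
  have hτC2 : τC ^ 2 = 1 := by
    refine AlgEquiv.ext fun c => ?_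
    obtain ⟨b, rfl⟩ := hπ c
    rw [pow_two, AlgEquiv.mul_apply, AlgEquiv.one_apply, ← hτπ, ← hτπ, hτ]
  obtain ⟨ℓ, hℓ⟩ : ∃ ℓ : L, σ ℓ ≠ ℓ := by
    by_contra h
    exact hσ1 (AlgEquiv.ext fun ℓ => not_ne_iff.1 (not_exists.1 h ℓ))
  have hℓC : τC (algebraMap L C ℓ) ≠ algebraMap L C ℓ := by
    rw [hτL]
    exact fun h => hℓ ((algebraMap L C).injective h)
  have hτC1 : τC ≠ 1 := fun h => hℓC (by rw [h, AlgEquiv.one_apply])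
  have hC2 : finrank ↥(IntermediateField.fixedField (Subgroup.zpowers τC)) C = 2 := by
    rw [IntermediateField.finrank_fixedField_eq_card, Nat.card_zpowers, orderOf_eq_prime hτC2 hτC1]
  have hℓK : ∃ ℓ : L, algebraMap L C ℓ ∉ IntermediateField.fixedField (Subgroup.zpowers τC) :=
    ⟨ℓ, fun h => hℓC ((IntermediateField.mem_fixedField_iff (Subgroup.zpowers τC) _).1 h τC (Subgroup.mem_zpowers τC))⟩
  -- the square `F ⊂ L, K₀ ⊂ C` is linearly disjoint
  obtain ⟨e, he⟩ := exists_algEquiv_tensor_of_finrank_eq_two F L C (IntermediateField.fixedField (Subgroup.zpowers τC))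
    (Algebra.IsQuadraticExtension.finrank_eq_two F L) hC2 hℓK
  -- `B ⧸ 𝔪 ≃ₐ[L] C` along `π`
  let πL : ↥(Algebra.adjoin L ({γ} : Set (Matrix (Fin N) (Fin N) L))) →ₐ[L] C :=
    { (π : ↥(Algebra.adjoin L ({γ} : Set (Matrix (Fin N) (Fin N) L))) →ₐ[F] C).toRingHom with commutes' := fun _ => rfl }
  have hπL : ∀ b, πL b = π b := fun _ => rfl
  have hπLs : Function.Surjective πL := hπ
  have hkerL : RingHom.ker πL = I.asIdeal := by
    ext b
    rw [RingHom.mem_ker]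
    exact hker b
  let eI : (↥(Algebra.adjoin L ({γ} : Set (Matrix (Fin N) (Fin N) L))) ⧸ I.asIdeal) ≃ₐ[L] C :=
    (Ideal.quotientEquivAlgOfEq L hkerL.symm).trans (Ideal.quotientKerAlgEquivOfSurjective hπLs)
  have heI : ∀ b, eI (Ideal.Quotient.mk I.asIdeal b) = π b := fun b => by
    change Ideal.quotientKerAlgEquivOfSurjective hπLs (Ideal.quotientEquivAlgOfEq L hkerL.symm (Ideal.Quotient.mk I.asIdeal b)) = _
    rw [Ideal.quotientEquivAlgOfEq_mk, Ideal.quotientKerAlgEquivOfSurjective_mk, hπL]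
  -- transport to `𝔸_C` (§2): the element becomes the image of `X` in `𝔸_C`, i.e. `con_{C∕K₀} W`
  have hXW : adeleRingTensorAlgEquiv F C
      (Algebra.TensorProduct.map (AlgHom.id (AdeleRing (𝓞 F) F) (AdeleRing (𝓞 F) F)) π ↑X) =
      NumberField.AdeleRing.baseChange ↥(IntermediateField.fixedField (Subgroup.zpowers τC)) C ↑W := by
    rw [← coe_ideleBaseChange_eq_baseChange, hW, Units.coe_map]
    rfl
  rw [norm_transfer_mk_eq_adeleRelNorm F L C _ I.asIdeal eI π heI θI hθI, hXW,
    adeleRelNorm_baseChange_eq_baseChange_adeleRelNorm F L _ C e (fun k => he k), coe_ideleRelNorm]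

end Stable

end Literature.NumberTheory.GaloisRepresentations

end
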